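import Literature.AlgebraicGeometry.HodgeTheory.FermatHodgeCharacterCriterion
import HarnessLib

/-!
# The Hodge condition at the sub-level `m/4` (`m = 4m'`, `m'` odd) and at a maximal exact level — Aoki 1983, Prop. 2.2

Topic `Literature/AlgebraicGeometry/HodgeTheory`. THEOREMS only (no definition, no named fact, no `sorry`).
Support file (XX) for the uniform treatment of [Aoki1983, Thm. C] at the levels `m = 4m'`,
`(m', 6) = 1` (route K₄ of the cell's scoping document: Aoki's case `ord₂ m = 2`, §9 (I-2),
(III-6)–(III-7) cases (i)–(iv), (V-1)–(V-2)), in the style of the support files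
`FermatHodgeCharacterSubLevel` (levels `m/2`, `m/3`), `FermatHodgeCharacterExactLevel` (XVIII, odd
conductors met at the exact levels `f`, `2f`) and `FermatHodgeCharacterTopLevel` (XIX, `f = m`).

For a Hodge character `α : Fin r → ℤ/m` and an odd primitive character `χ` of conductor `f ∣ m`,
Aoki's criterion ([Aoki1983, Prop. 2.1/2.2]; the tree's `IsHodge.aoki_criterion`) reads, coordinate
by coordinate (`αᵢ = (m/Mᵢ) wᵢ`, `Mᵢ` the exact level, `wᵢ` a unit mod `Mᵢ`):
`∑_{f ∣ Mᵢ} (φ(m)/φ(Mᵢ)) ∏_{p ∣ Mᵢ} (1 - χ(p)) χ(wᵢ mod f)⁻¹ = 0`.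
* **`IsHodge.rel_max_level_conj`** — if every exact level `Mᵢ` divisible by `f` EQUALS `f` (e.g.
  `f` = the largest exact level occurring), the relation is `∑_{Mᵢ = f} χ(wᵢ mod f) = 0` (weight
  `φ(m)/φ(f)` common, Euler factor `1`); any `f`, odd or even. Aoki's "`τ_{d₀}(α) =
  (φ(m)/φ(m/d₀)) (1) ∈ A(m/d₀)`" of §9 (V-1) and the top conductor `f = m` of (II)–(IV).
* **`IsHodge.rel_quarter_level`** — `m = 4m'`, `m'` odd, conductor `f = m'`: a unit coordinate
  contributes `(1 - χ(2)⁻¹) χ(ᾱᵢ)` (level `4m'`, weight `1`, Euler factor at `2`), a coordinate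
  `≡ 2 (mod 4)` prime to `m'` contributes `2 (1 - χ(2)⁻¹) χ(2)⁻¹ χ(ᾱᵢ)` (level `2m'`, weight
  `φ(4m')/φ(2m') = 2`), a coordinate `≡ 0 (mod 4)` prime to `m'` contributes `2 χ(4)⁻¹ χ(ᾱᵢ)`
  (level `m'`, weight `2`, no Euler factor), the others nothing (`ᾱᵢ = αᵢ mod m'`). With
  `v = -2⁻¹` mod `m'` (`χ(v) = -χ(2)⁻¹`) these are the twins `χ(ᾱᵢ) + χ(vᾱᵢ)`, the doubled twins
  `2(χ(ȳ) + χ(vȳ))`, `ȳ = ᾱᵢ/2`, and the doubled single points `2χ(ᾱᵢ/4)`: Aoki's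
  "`τ₄(α) = (1, -εv_δ, b, -ε'v_δ'b)`" (I-2), "`(1, -2⁻¹)(1, b', c') ∈ A(m/4)`" (III-7 (i)),
  "`(1, -2⁻¹)(1, b') + (c') ∈ A(m/4)`" (III-7 (ii)).

HONEST FRAMING (cell `pub-hfermat`): explicit algebraic cycles for specific Hodge classes on
Fermat/Delsarte varieties; residual open instances listed; no claim on general Hodge. (Surface
classes are algebraic by Lefschetz (1,1); this file is a relation among Hodge characters, no case
of HC.)

## References
* [Aoki1983] N. Aoki, *On some arithmetic problems related to the Hodge cycles on the Fermat varieties*,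
  Math. Ann. 266 (1983) 23–54 — Props. 2.1, 2.2 (pp. 28–29, the terms `L_ψ(αᵢ)`), §9 (I-2) p. 47,
  (III-6)–(III-7) pp. 50–51, (V-1) p. 53.
-/

noncomputable section

open Finset

namespace Literature.AlgebraicGeometry.HodgeTheory

namespace FermatCharacter

/-! ### The Hodge condition at a conductor met only at the exact level `f` itself -/

section MaxLevel

variable {m : ℕ}

/-- `χ` vanishes at the primes of its level: `∏_{p ∣ f} (1 - χ(p)) = 1`. [folklore] -/
private theorem prod_primeFactors_one_sub_eq_one {f : ℕ} (χ : DirichletCharacter ℂ f) :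
    ∏ p ∈ f.primeFactors, (1 - χ (p : ZMod f)) = 1 := by
  refine Finset.prod_eq_one fun p hp ↦ ?_
  have hpf : p ∣ f := Nat.dvd_of_mem_primeFactors hp
  have hp1 : p.Prime := Nat.prime_of_mem_primeFactors hp
  have hnu : ¬ IsUnit ((p : ℕ) : ZMod f) := by
    rw [ZMod.isUnit_iff_coprime]
    intro hc
    exact hp1.one_lt.ne' (Nat.Coprime.eq_one_of_dvd hc hpf)
  rw [χ.map_nonunit hnu, sub_zero]

/-- **[Aoki1983, Prop. 2.2] at a conductor `f ∣ m` met only at the exact level `f`.** Let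
`α = (α₀, …, α_{r-1})` be a Hodge character of level `m`, `αᵢ = (m/Mᵢ) wᵢ` with `Mᵢ ∣ m` and `wᵢ`
a unit mod `Mᵢ`, and let `f ∣ m` be such that every `Mᵢ` divisible by `f` equals `f` (for
instance `f` = the largest `Mᵢ`). Then `∑_{Mᵢ = f} χ(wᵢ mod f) = 0` for every odd primitive
character `χ` mod `f` (the weights `φ(m)/φ(f)` are equal, the Euler factors `∏_{p ∣ f}(1 - χ(p))`
are `1`; complex conjugate of `IsHodge.aoki_criterion`). Aoki's "`τ_{d₀}(α) = (φ(m)/φ(m/d₀)) (1)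
∈ A(m/d₀), and hence (1) ∈ A(m/d₀). But this is impossible" of §9 (V-1), for any parity of
`m/d₀`. [cite: Aoki1983, Prop. 2.2; §9 (V-1) p. 53] -/
theorem IsHodge.rel_max_level_conj [NeZero m] {r : ℕ} {α : Fin r → ZMod m} (h : IsHodge α)
    {f : ℕ} [NeZero f] (hfm : f ∣ m) {χ : DirichletCharacter ℂ f} (hχ : χ.Odd)
    (hprim : χ.IsPrimitive) (M : Fin r → ℕ) [∀ i, NeZero (M i)] (hM : ∀ i, M i ∣ m)
    (w : (i : Fin r) → ZMod (M i)) (hw : ∀ i, IsUnit (w i))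
    (hα : ∀ i, α i = ((m / M i : ℕ) : ZMod m) * ((ZMod.val (w i) : ℕ) : ZMod m))
    (hlev : ∀ i, f ∣ M i → M i = f) :
    ∑ i, (if M i = f then χ (ZMod.cast (w i) : ZMod f) else 0) = 0 := by
  classical
  have hm0 : m ≠ 0 := NeZero.ne m
  have hf0 : f ≠ 0 := NeZero.ne f
  have key := h.aoki_criterion hfm hχ hprim M hM w hw hα
  set c : ℂ := (m.totient : ℂ) / (f.totient : ℂ) with hc
  have hc0 : c ≠ 0 := div_ne_zero
    (by exact_mod_cast (Nat.totient_pos.mpr (Nat.pos_of_ne_zero hm0)).ne')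
    (by exact_mod_cast (Nat.totient_pos.mpr (Nat.pos_of_ne_zero hf0)).ne')
  have hterm : ∀ i, (if f ∣ M i then ((m.totient : ℂ) / ((M i).totient : ℂ)) *
        (∏ p ∈ (M i).primeFactors, (1 - χ p)) * (χ (ZMod.cast (w i) : ZMod f))⁻¹ else 0) =
      c * (if M i = f then (χ (ZMod.cast (w i) : ZMod f))⁻¹ else 0) := by
    intro i
    by_cases hfi : f ∣ M i
    · have h1 := hlev i hfi
      have ht : ((M i).totient : ℂ) = f.totient := by rw [h1]
      have hp : ∏ p ∈ (M i).primeFactors, (1 - χ (p : ZMod f)) = 1 := by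
        rw [h1]; exact prod_primeFactors_one_sub_eq_one χ
      rw [if_pos hfi, ht, hp, if_pos h1, hc, mul_one]
    · have hne1 : ¬ M i = f := fun h1 ↦ hfi (h1 ▸ dvd_refl f)
      rw [if_neg hfi, if_neg hne1, mul_zero]
  rw [Finset.sum_congr rfl (fun i _ ↦ hterm i), ← Finset.mul_sum] at key
  have key' := (mul_eq_zero.mp key).resolve_left hc0
  -- conjugate: `(χ y)⁻¹ = conj (χ y)`
  have hinv : ∀ y : ZMod f, (χ y)⁻¹ = starRingEnd ℂ (χ y) := by
    intro y
    by_cases hy : IsUnit y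
    · exact Complex.inv_eq_conj (χ.unit_norm_eq_one hy.unit ▸ by rw [IsUnit.unit_spec])
    · rw [χ.map_nonunit hy, inv_zero, map_zero]
  have hterm' : ∀ i, (if M i = f then χ (ZMod.cast (w i) : ZMod f) else 0) =
      starRingEnd ℂ (if M i = f then (χ (ZMod.cast (w i) : ZMod f))⁻¹ else 0) := by
    intro i
    by_cases h1 : M i = f
    · rw [if_pos h1, if_pos h1, map_inv₀, ← hinv, inv_inv]
    · rw [if_neg h1, if_neg h1, map_zero]
  rw [Finset.sum_congr rfl fun i _ ↦ hterm' i, ← map_sum, key', map_zero]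

end MaxLevel

/-! ### The Hodge condition at the level `m' = m/4` (Aoki's `τ₄(α) ∈ A(m/4)`, [Aoki1983, Prop. 2.2]) -/

section QuarterLevel

variable {n : ℕ} [NeZero n]

omit [NeZero n] in
/-- `4n ≠ 0`. [folklore] -/
private theorem four_mul_ne_zero' (hn0 : n ≠ 0) : 4 * n ≠ 0 := mul_ne_zero four_ne_zero hn0

/-- The reduction `ℤ/4n → ℤ/n` of `x` is the residue of `⟨x⟩`. [folklore] -/
private theorem castHom_quarter_eq_val (x : ZMod (4 * n)) :
    ZMod.castHom (dvd_mul_left n 4) (ZMod n) x = ((x.val : ℕ) : ZMod n) := by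
  haveI : NeZero (4 * n) := ⟨four_mul_ne_zero' (NeZero.ne n)⟩
  conv_lhs => rw [← ZMod.natCast_zmod_val x]
  rw [map_natCast]

/-- The reduction `ℤ/4n → ℤ/4` of `x` is the residue of `⟨x⟩`. [folklore] -/
private theorem castHom_four_eq_val (x : ZMod (4 * n)) :
    ZMod.castHom (dvd_mul_right 4 n) (ZMod 4) x = ((x.val : ℕ) : ZMod 4) := by
  haveI : NeZero (4 * n) := ⟨four_mul_ne_zero' (NeZero.ne n)⟩
  conv_lhs => rw [← ZMod.natCast_zmod_val x]
  rw [map_natCast]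

omit [NeZero n] in
/-- For a unit `x` of `ℤ/4n`: `gcd(4n, ⟨x⟩) = 1`. [folklore] -/
private theorem gcd_eq_one_of_isUnit₄ {x : ZMod (4 * n)} (hu : IsUnit x) :
    (4 * n).gcd x.val = 1 := by
  have h := ZMod.val_coe_unit_coprime hu.unit
  rw [IsUnit.unit_spec] at h
  rw [Nat.gcd_comm]
  exact h

/-- For a non-unit `x` of `ℤ/4n` (`n` odd) whose reduction mod `n` is a unit: `gcd(4n, ⟨x⟩) = 2`
if `x ≡ 2 (mod 4)`, and `gcd(4n, ⟨x⟩) = 4` (`x ≡ 0 (mod 4)`) otherwise. [folklore] -/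
private theorem gcd_cases_of_not_isUnit {x : ZMod (4 * n)} (hu : ¬ IsUnit x)
    (hu' : IsUnit (ZMod.castHom (dvd_mul_left n 4) (ZMod n) x)) :
    (ZMod.castHom (dvd_mul_right 4 n) (ZMod 4) x = 2 ∧ (4 * n).gcd x.val = 2) ∨
    (ZMod.castHom (dvd_mul_right 4 n) (ZMod 4) x ≠ 2 ∧ (4 * n).gcd x.val = 4) := by
  haveI : NeZero (4 * n) := ⟨four_mul_ne_zero' (NeZero.ne n)⟩
  rw [castHom_quarter_eq_val, ZMod.isUnit_iff_coprime] at hu'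
  rw [castHom_four_eq_val]
  have hnot : ¬ x.val.Coprime (4 * n) := by
    intro hc
    apply hu
    rw [← ZMod.natCast_zmod_val x, ZMod.isUnit_iff_coprime]
    exact hc
  have hg : Nat.gcd x.val (4 * n) = Nat.gcd x.val 4 :=
    Nat.Coprime.gcd_mul_right_cancel_right 4 (Nat.coprime_comm.mp hu')
  rw [Nat.gcd_comm, hg, Nat.gcd_comm, Nat.gcd_rec]
  have hne1 : Nat.gcd (x.val % 4) 4 ≠ 1 := by
    intro h1
    apply hnot
    rw [Nat.coprime_iff_gcd_eq_one, hg, Nat.gcd_comm, Nat.gcd_rec, h1]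
  have h2iff : ((x.val : ℕ) : ZMod 4) = 2 ↔ x.val % 4 = 2 := by
    rw [show (2 : ZMod 4) = ((2 : ℕ) : ZMod 4) by norm_cast, ZMod.natCast_eq_natCast_iff']
  rw [h2iff]
  obtain h0 | h1 | h2 | h3 : x.val % 4 = 0 ∨ x.val % 4 = 1 ∨ x.val % 4 = 2 ∨ x.val % 4 = 3 := by
    omega
  · right; rw [h0]; exact ⟨by rw [Ne, h2iff]; omega, Nat.gcd_zero_left 4⟩
  · rw [h1] at hne1; exact absurd (Nat.gcd_one_left 4) hne1
  · left; rw [h2]; exact ⟨rfl, by norm_num⟩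
  · rw [h3] at hne1; exact absurd (by norm_num) hne1

/-- If the reduction of `x ∈ ℤ/4n` mod `n` (`n` odd) is NOT a unit, the level `4n/gcd(4n, ⟨x⟩)`
of `x` is not a multiple of `n`. [folklore] -/
private theorem not_dvd_level_of_not_isUnit₄ (hn : Odd n) {x : ZMod (4 * n)}
    (hu' : ¬ IsUnit (ZMod.castHom (dvd_mul_left n 4) (ZMod n) x)) :
    ¬ n ∣ 4 * n / (4 * n).gcd x.val := by
  haveI : NeZero (4 * n) := ⟨four_mul_ne_zero' (NeZero.ne n)⟩
  have hn0 : n ≠ 0 := NeZero.ne n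
  rw [castHom_quarter_eq_val, ZMod.isUnit_iff_coprime] at hu'
  set g := (4 * n).gcd x.val with hg
  set d := Nat.gcd x.val n with hd
  have hd1 : d ≠ 1 := fun h1 ↦ hu' h1
  have hdg : d ∣ g := Nat.dvd_gcd ((Nat.gcd_dvd_right _ _).trans (dvd_mul_left n 4))
    (Nat.gcd_dvd_left _ _)
  have hdodd : Odd d := Odd.of_dvd_nat hn (Nat.gcd_dvd_right _ _)
  intro h
  obtain ⟨t, ht⟩ := h
  have hgdvd : g ∣ 4 * n := Nat.gcd_dvd_left _ _
  have hmul : 4 * n / g * g = 4 * n := Nat.div_mul_cancel hgdvd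
  rw [ht] at hmul
  -- `n t g = 4 n`, so `t g = 4` and `g ∣ 4`
  have htg : t * g = 4 := by
    have : n * (t * g) = n * 4 := by rw [← mul_assoc, hmul, mul_comm]
    exact Nat.eq_of_mul_eq_mul_left (Nat.pos_of_ne_zero hn0) this
  have hg4 : g ∣ 4 := ⟨t, by rw [mul_comm, htg]⟩
  have hd4 : d ∣ 4 := hdg.trans hg4
  have hdle : d ≤ 4 := Nat.le_of_dvd (by norm_num) hd4
  have hd0 : 0 < d := Nat.pos_of_ne_zero fun h0 ↦ by rw [h0] at hdodd; exact absurd hdodd (by decide)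
  interval_cases d
  · exact hd1 rfl
  · exact absurd hdodd (by decide)
  · exact absurd hd4 (by decide)
  · exact absurd hdodd (by decide)

/-- The `i`-th term of Aoki's criterion at the level `n` for a coordinate `x ∈ ℤ/4n` (`n` odd),
written with the exact level `M = 4n/gcd(4n, ⟨x⟩)` and unit part `w` of `x`: it is
`(1 - χ(2)) χ(x̄)⁻¹` for a unit `x` (weight `1`), `2 (1 - χ(2)) χ(2) χ(x̄)⁻¹` for `x ≡ 2 (mod 4)`
prime to `n` (level `2n`, weight `φ(4n)/φ(2n) = 2`), `2 χ(4) χ(x̄)⁻¹` for `x ≡ 0 (mod 4)` prime to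
`n` (level `n`, weight `2`), and `0` when `x̄ = x mod n` is not a unit.
[cite: Aoki1983, Prop. 2.1 and Prop. 2.2 (the terms `L_ψ(αᵢ)`)] -/
private theorem quarter_term (hn : Odd n) (x : ZMod (4 * n))
    [NeZero (4 * n / (4 * n).gcd x.val)] (w : ZMod (4 * n / (4 * n).gcd x.val))
    (hwx : ((4 * n / (4 * n / (4 * n).gcd x.val) : ℕ) : ZMod (4 * n)) *
      ((w.val : ℕ) : ZMod (4 * n)) = x)
    (χ : DirichletCharacter ℂ n) :
    (if n ∣ 4 * n / (4 * n).gcd x.val then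
        (((4 * n).totient : ℂ) / ((4 * n / (4 * n).gcd x.val).totient : ℂ)) *
          (∏ p ∈ (4 * n / (4 * n).gcd x.val).primeFactors, (1 - χ p)) *
          (χ (ZMod.cast w : ZMod n))⁻¹ else 0) =
      if IsUnit x then (1 - χ 2) * (χ (ZMod.castHom (dvd_mul_left n 4) (ZMod n) x))⁻¹
      else if IsUnit (ZMod.castHom (dvd_mul_left n 4) (ZMod n) x) then
        (if ZMod.castHom (dvd_mul_right 4 n) (ZMod 4) x = 2 then
          2 * (1 - χ 2) * χ 2 * (χ (ZMod.castHom (dvd_mul_left n 4) (ZMod n) x))⁻¹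
        else 2 * χ 4 * (χ (ZMod.castHom (dvd_mul_left n 4) (ZMod n) x))⁻¹) else 0 := by
  classical
  have hn0 : n ≠ 0 := NeZero.ne n
  haveI : NeZero (4 * n) := ⟨four_mul_ne_zero' hn0⟩
  have h4n0 : 0 < 4 * n := Nat.pos_of_ne_zero (four_mul_ne_zero' hn0)
  have hcop2n : Nat.Coprime 2 n := Nat.coprime_two_left.mpr hn
  have hcop4n : Nat.Coprime 4 n := by
    simpa [show (4 : ℕ) = 2 ^ 2 by norm_num] using hcop2n.pow_left 2
  set φ := ZMod.castHom (dvd_mul_left n 4) (ZMod n) with hφ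
  set ψ₄ := ZMod.castHom (dvd_mul_right 4 n) (ZMod 4) with hψ₄
  -- the cast of `w` is the residue of `⟨w⟩`
  have hcw : (ZMod.cast w : ZMod n) = ((w.val : ℕ) : ZMod n) := ZMod.cast_eq_val w
  rw [hcw]
  -- `χ` vanishes on the primes of `n`
  have hprimes : ∀ q ∈ n.primeFactors, (1 - χ (q : ZMod n)) = 1 := by
    intro q hq
    have hqn : q ∣ n := Nat.dvd_of_mem_primeFactors hq
    have hq1 : q.Prime := Nat.prime_of_mem_primeFactors hq
    have hnu : ¬ IsUnit ((q : ℕ) : ZMod n) := by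
      rw [ZMod.isUnit_iff_coprime]
      intro hc
      exact hq1.one_lt.ne' (Nat.Coprime.eq_one_of_dvd hc hqn)
    rw [χ.map_nonunit hnu, sub_zero]
  have h2nmem : (2 : ℕ) ∉ n.primeFactors := fun h ↦
    (Nat.not_even_iff_odd.mpr hn) (even_iff_two_dvd.mpr (Nat.dvd_of_mem_primeFactors h))
  have hφn0 : ((n.totient : ℕ) : ℂ) ≠ 0 := by
    exact_mod_cast (Nat.totient_pos.mpr (Nat.pos_of_ne_zero hn0)).ne'
  have htot4n : ((4 * n).totient : ℂ) = 2 * (n.totient : ℂ) := by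
    rw [Nat.totient_mul hcop4n, show (4 : ℕ).totient = 2 by decide]
    push_cast; ring
  -- `χ(2), χ(4) ≠ 0`
  have h2u : IsUnit (2 : ZMod n) := by
    rw [show (2 : ZMod n) = ((2 : ℕ) : ZMod n) by norm_cast, ZMod.isUnit_iff_coprime]
    exact hcop2n
  have hχ2 : χ 2 ≠ 0 := fun h0 ↦ by
    have := DirichletCharacter.unit_norm_eq_one χ h2u.unit
    rw [IsUnit.unit_spec, h0, norm_zero] at this
    exact zero_ne_one this
  have hχ4 : χ 4 ≠ 0 := by
    rw [show (4 : ZMod n) = 2 * 2 by norm_num, map_mul]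
    exact mul_ne_zero hχ2 hχ2
  by_cases hu : IsUnit x
  · -- unit: `M = 4n`, `w = x`
    have hg1 : (4 * n).gcd x.val = 1 := gcd_eq_one_of_isUnit₄ hu
    have h1 : 4 * n / (4 * n / (4 * n).gcd x.val) = 1 := by
      rw [hg1, Nat.div_one, Nat.div_self h4n0]
    rw [h1, Nat.cast_one, one_mul] at hwx
    have hwφ : ((w.val : ℕ) : ZMod n) = φ x := by
      have := congrArg φ hwx
      rwa [map_natCast] at this
    rw [hwφ, if_pos hu]
    have hM : 4 * n / (4 * n).gcd x.val = 4 * n := by rw [hg1, Nat.div_one]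
    rw [hM, if_pos (dvd_mul_left n 4), div_self (by exact_mod_cast (Nat.totient_pos.mpr h4n0).ne'),
      one_mul, Nat.primeFactors_mul four_ne_zero hn0,
      show (4 : ℕ).primeFactors = {2} by
        rw [show (4 : ℕ) = 2 ^ 2 by norm_num, Nat.primeFactors_prime_pow two_ne_zero Nat.prime_two],
      show ({2} ∪ n.primeFactors : Finset ℕ) = insert 2 n.primeFactors from rfl,
      Finset.prod_insert h2nmem, Finset.prod_eq_one hprimes, mul_one, Nat.cast_ofNat]
  · by_cases hu' : IsUnit (φ x)
    · rw [if_neg hu, if_pos hu']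
      rcases gcd_cases_of_not_isUnit hu hu' with ⟨hψ2, hg2⟩ | ⟨hψ2, hg4⟩
      · -- `x ≡ 2 (mod 4)` prime to `n`: `M = 2n`, `2w ≡ x`
        have hMn : 4 * n / (4 * n).gcd x.val = 2 * n := by
          rw [hg2, show 4 * n = 2 * (2 * n) by ring, Nat.mul_div_cancel_left (2 * n) two_pos]
        have h2 : 4 * n / (4 * n / (4 * n).gcd x.val) = 2 := by
          rw [hMn, show 4 * n = 2 * (2 * n) by ring,
            Nat.mul_div_cancel 2 (Nat.pos_of_ne_zero (mul_ne_zero two_ne_zero hn0))]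
        rw [h2, Nat.cast_ofNat] at hwx
        have hwφ : (2 : ZMod n) * ((w.val : ℕ) : ZMod n) = φ x := by
          have := congrArg φ hwx
          rwa [map_mul, map_natCast, map_ofNat] at this
        have hval : (χ ((w.val : ℕ) : ZMod n))⁻¹ = χ 2 * (χ (φ x))⁻¹ := by
          rw [← hwφ, map_mul, mul_inv, ← mul_assoc, mul_inv_cancel₀ hχ2, one_mul]
        rw [hval, if_pos hψ2, hMn, if_pos (dvd_mul_left n 2), htot4n, Nat.totient_mul hcop2n,
          Nat.totient_two, one_mul, Nat.primeFactors_mul two_ne_zero hn0,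
          Nat.prime_two.primeFactors,
          show ({2} ∪ n.primeFactors : Finset ℕ) = insert 2 n.primeFactors from rfl,
          Finset.prod_insert h2nmem, Finset.prod_eq_one hprimes, mul_one, Nat.cast_ofNat]
        field_simp
      · -- `x ≡ 0 (mod 4)` prime to `n`: `M = n`, `4w ≡ x`
        have hMn : 4 * n / (4 * n).gcd x.val = n := by
          rw [hg4, Nat.mul_div_cancel_left n (by norm_num : 0 < 4)]
        have h4 : 4 * n / (4 * n / (4 * n).gcd x.val) = 4 := by
          rw [hMn, Nat.mul_div_cancel 4 (Nat.pos_of_ne_zero hn0)]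
        rw [h4, Nat.cast_ofNat] at hwx
        have hwφ : (4 : ZMod n) * ((w.val : ℕ) : ZMod n) = φ x := by
          have := congrArg φ hwx
          rwa [map_mul, map_natCast, map_ofNat] at this
        have hval : (χ ((w.val : ℕ) : ZMod n))⁻¹ = χ 4 * (χ (φ x))⁻¹ := by
          rw [← hwφ, map_mul, mul_inv, ← mul_assoc, mul_inv_cancel₀ hχ4, one_mul]
        rw [hval, if_neg hψ2, hMn, if_pos (dvd_refl n), htot4n, Finset.prod_eq_one hprimes,
          mul_one]
        field_simp
    · -- `x̄` not a unit: no term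
      rw [if_neg (not_dvd_level_of_not_isUnit₄ hn hu'), if_neg hu, if_neg hu']

/-- **The Hodge condition at the level `m' = m/4`** for `m = 4m'`, `m'` odd ([Aoki1983, Prop. 2.2]
at `f = m'`; Aoki's "`τ₄(α) ∈ A(m/4)`" in §9 (I-2), (III-7)): for a Hodge character
`α : Fin r → ℤ/4m'` and every odd primitive character `χ` mod `m'`,
`∑_{αᵢ unit} (1 - χ(2)⁻¹) χ(ᾱᵢ) + 2 ∑_{αᵢ ≡ 2 (4), ᾱᵢ unit} (1 - χ(2)⁻¹) χ(2)⁻¹ χ(ᾱᵢ)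
  + 2 ∑_{αᵢ ≡ 0 (4), ᾱᵢ unit} χ(4)⁻¹ χ(ᾱᵢ) = 0`
(`ᾱᵢ = αᵢ mod m'`; coordinates sharing an odd prime with `m'` do not contribute). With
`v = -2⁻¹` the three sums are `∑ (χ(ᾱᵢ) + χ(vᾱᵢ))`, `2 ∑ (χ(ȳᵢ) + χ(vȳᵢ))` (`ȳᵢ = ᾱᵢ/2`) and
`2 ∑ χ(ᾱᵢ/4)`. [cite: Aoki1983, Prop. 2.2; §9 (I-2) p. 47, (III-7) pp. 50–51] -/
theorem IsHodge.rel_quarter_level (hn : Odd n) {r : ℕ} {α : Fin r → ZMod (4 * n)}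
    (hα : IsHodge α) (χ : DirichletCharacter ℂ n) (hχ : χ.Odd) (hprim : χ.IsPrimitive) :
    ∑ i, (if IsUnit (α i) then
        (1 - (χ 2)⁻¹) * χ (ZMod.castHom (dvd_mul_left n 4) (ZMod n) (α i))
      else if IsUnit (ZMod.castHom (dvd_mul_left n 4) (ZMod n) (α i)) then
        (if ZMod.castHom (dvd_mul_right 4 n) (ZMod 4) (α i) = 2 then
          2 * (1 - (χ 2)⁻¹) * (χ 2)⁻¹ * χ (ZMod.castHom (dvd_mul_left n 4) (ZMod n) (α i))
        else 2 * (χ 4)⁻¹ * χ (ZMod.castHom (dvd_mul_left n 4) (ZMod n) (α i)))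
      else 0) = 0 := by
  classical
  have hn0 : n ≠ 0 := NeZero.ne n
  haveI : NeZero (4 * n) := ⟨four_mul_ne_zero' hn0⟩
  set φ := ZMod.castHom (dvd_mul_left n 4) (ZMod n) with hφ
  set ψ₄ := ZMod.castHom (dvd_mul_right 4 n) (ZMod 4) with hψ₄
  have H := fun i ↦ exists_unit_lift_eq (m := 4 * n) (α i)
  choose w hwu hwx using fun i ↦ (H i).2
  haveI : ∀ i, NeZero (4 * n / (4 * n).gcd (α i).val) := fun i ↦
    ⟨(Nat.div_pos (Nat.le_of_dvd (NeZero.pos (4 * n)) (Nat.gcd_dvd_left _ _))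
      (Nat.gcd_pos_of_pos_left _ (NeZero.pos (4 * n)))).ne'⟩
  have key := hα.aoki_criterion (dvd_mul_left n 4) hχ hprim
    (fun i ↦ 4 * n / (4 * n).gcd (α i).val) (fun i ↦ (H i).1) w hwu (fun i ↦ (hwx i).symm)
  have key' : ∑ i, (if IsUnit (α i) then (1 - χ 2) * (χ (φ (α i)))⁻¹
      else if IsUnit (φ (α i)) then
        (if ψ₄ (α i) = 2 then 2 * (1 - χ 2) * χ 2 * (χ (φ (α i)))⁻¹
          else 2 * χ 4 * (χ (φ (α i)))⁻¹) else 0) = 0 := by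
    rw [Finset.sum_congr rfl fun i _ ↦ (quarter_term hn (α i) (w i) (hwx i) χ).symm]
    exact key
  -- conjugate: `(χ y)⁻¹ = conj (χ y)`
  have hinv : ∀ y : ZMod n, (χ y)⁻¹ = starRingEnd ℂ (χ y) := by
    intro y
    by_cases hy : IsUnit y
    · exact Complex.inv_eq_conj (χ.unit_norm_eq_one hy.unit ▸ by rw [IsUnit.unit_spec])
    · rw [χ.map_nonunit hy, inv_zero, map_zero]
  have c2 : starRingEnd ℂ (2 : ℂ) = 2 := map_ofNat _ 2
  have hterm : ∀ i, (if IsUnit (α i) then (1 - (χ 2)⁻¹) * χ (φ (α i))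
      else if IsUnit (φ (α i)) then
        (if ψ₄ (α i) = 2 then 2 * (1 - (χ 2)⁻¹) * (χ 2)⁻¹ * χ (φ (α i))
          else 2 * (χ 4)⁻¹ * χ (φ (α i))) else 0) =
      starRingEnd ℂ (if IsUnit (α i) then (1 - χ 2) * (χ (φ (α i)))⁻¹
        else if IsUnit (φ (α i)) then
          (if ψ₄ (α i) = 2 then 2 * (1 - χ 2) * χ 2 * (χ (φ (α i)))⁻¹
            else 2 * χ 4 * (χ (φ (α i)))⁻¹) else 0) := by
    intro i
    by_cases hu : IsUnit (α i)
    · rw [if_pos hu, if_pos hu, map_mul, map_sub, map_one, map_inv₀, ← hinv, ← hinv, inv_inv]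
    · by_cases hu' : IsUnit (φ (α i))
      · by_cases h2 : ψ₄ (α i) = 2
        · rw [if_neg hu, if_pos hu', if_pos h2, if_neg hu, if_pos hu', if_pos h2, map_mul, map_mul,
            map_mul, map_sub, map_one, map_inv₀, c2, ← hinv, ← hinv, inv_inv]
        · rw [if_neg hu, if_pos hu', if_neg h2, if_neg hu, if_pos hu', if_neg h2, map_mul, map_mul,
            map_inv₀, c2, ← hinv, ← hinv, inv_inv]
      · rw [if_neg hu, if_neg hu', if_neg hu, if_neg hu', map_zero]
  rw [Finset.sum_congr rfl fun i _ ↦ hterm i, ← map_sum, key', map_zero]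

end QuarterLevel

end FermatCharacter

end Literature.AlgebraicGeometry.HodgeTheory
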